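import Literature.AlgebraicGeometry.Modules.PullbackTensor
import Literature.AlgebraicGeometry.Modules.SheafHomFrames
import Literature.AlgebraicGeometry.Modules.BoxTensor
import Literature.AlgebraicGeometry.Modules.IsoOfSectionsOnBasis
import HarnessLib

/-!
# The comparison `L ⊗ E ⟶ 𝓗om(L^∨, E)`, `l ⊗ s ↦ (λ ↦ λ(l) s)` (Hartshorne II Ex. 5.1 (b))

Layer `Literature/AlgebraicGeometry/Modules`, namespace `Literature.AlgebraicGeometry.Modules`.
DEFINITIONS (plumbing) AND THEOREMS; no named fact, no instance, no notation.

The tree has two models of "twisting by `L`": the sheafified tensor product `tensorObj L E = L ⊗ E`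
(`Modules/TensorProduct`, Stacks 01CA; `Modules.tensorBifunctor`) and the internal-Hom model
`𝓗om(L^∨, E) = sheafHom (dual L) E` used for `E ⊗ Ω¹`, the Atiyah class and the twist frames
(`Modules/SheafHom*`, `Modules/SheafHomFrames.twistFrame`; Hartshorne II Ex. 5.1 (b):
"`𝓗om(𝓔, 𝓕) ≅ 𝓔^∨ ⊗ 𝓕` for `𝓔` locally free of finite rank"). This file builds the canonical
comparison between them, for ALL `𝒪_X`-modules `L`, `E`:

* §1 `twistHomOfSections L E U l s : L^∨|_U ⟶ E|_U` — the morphism `λ ↦ λ(l) • s` attached to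
  sections `l ∈ Γ(L, U)`, `s ∈ Γ(E, U)` (= `evalAt l ≫ smulSection s`, the tree's `twistBasis` for
  arbitrary sections), its values, bilinearity and restriction;
* §2 `tensorSheafHomDualPre L E` — the presheaf-level map `L(U) ⊗_{𝒪(U)} E(U) → Γ(𝓗om(L^∨, E), U)`
  and **`tensorSheafHomDual L E : L ⊗ E ⟶ 𝓗om(L^∨, E)`**, its sheafification-transpose, with the
  section formula `tensorSheafHomDual_app_tmulSection : θ(l ⊗ s) = (λ ↦ λ(l) • s)`;
* §3 `tensorObj_hom_ext` — two morphisms out of `M ⊗ N` that agree on all elementary tensors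
  `m ⊗ n` are equal (universal property of sheafification + `TensorProduct.ext`);
* §4 naturality of `θ` in `E` (`tensorSheafHomDual_naturality`: `(𝟙 ⊗ g) ≫ θ = θ ≫ 𝓗om(L^∨, g)`),
  i.e. a natural transformation `L ⊗ – ⟶ 𝓗om(L^∨, –)` (`tensorSheafHomDualNatTrans`).

That `θ` is an ISOMORPHISM for `L` finite locally free (Hartshorne II Ex. 5.1 (b)) is the sequel's
business (`Modules/TensorSheafHomIso`): it needs the sections of `L ⊗ E` below a frame
neighbourhood of `L` for an ARBITRARY `E`.

## References

* R. Hartshorne, *Algebraic Geometry*, GTM 52 (1977), II Ex. 5.1 (b) (p. 123). [Hartshorne1977]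
* The Stacks Project, Tag 01CA (tensor product), Tag 01CM (internal Hom). [StacksProject]
-/

noncomputable section

-- `TopCat.Presheaf`/`Scheme.Modules` are not reducible (as in Mathlib's `AlgebraicGeometry/Modules/Sheaf.lean`).
set_option backward.isDefEq.respectTransparency false

open CategoryTheory AlgebraicGeometry Opposite TopologicalSpace MonoidalCategory
open scoped TensorProduct

universe u

namespace Literature.AlgebraicGeometry.Modules

variable {X : Scheme.{u}}

/-! ### §1 The morphism `λ ↦ λ(l) • s : L^∨|_U ⟶ E|_U` of two sections -/

section Sections

variable (L E : X.Modules) {U V W : X.Opens}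

/-- **`λ ↦ λ(l) • s`**: the morphism `L^∨|_U ⟶ E|_U` attached to `l ∈ Γ(L, U)` and `s ∈ Γ(E, U)` —
evaluation at `l` followed by multiplication by `s` (the tree's `twistBasis` for arbitrary sections).
[cite: Hartshorne1977, II Ex. 5.1 (b)] -/
def twistHomOfSections (U : X.Opens) (l : Γ(L, U)) (s : Γ(E, U)) : (dual L).over U ⟶ E.over U :=
  evalAt (M := unitModule X) l ≫ smulSection s

variable {L E}

/-- Values: `(λ ↦ λ(l) • s)(μ) = μ(l|_W) • s|_W` for `μ ∈ Γ(L^∨, W)`, `W ≤ U`. [cite: Hartshorne1977, II Ex. 5.1 (b)] -/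
theorem appLE_twistHomOfSections (l : Γ(L, U)) (s : Γ(E, U)) (k : W ⟶ U)
    (μ : L.over W ⟶ (unitModule X).over W) :
    appLE (twistHomOfSections L E U l s) k (μ : Γ(dual L, W)) =
      (show Γ(X, W) from appLE μ (𝟙 W) (L.presheaf.map k.op l)) • E.presheaf.map k.op s := by
  unfold twistHomOfSections
  rw [appLE_comp, appLE_evalAt, appLE_smulSection]

/-- Additivity in `l`. [cite: Hartshorne1977, II Ex. 5.1 (b)] -/
theorem twistHomOfSections_add_left (l l' : Γ(L, U)) (s : Γ(E, U)) :
    twistHomOfSections L E U (l + l') s = twistHomOfSections L E U l s + twistHomOfSections L E U l' s := by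
  rw [twistHomOfSections, evalAt_add, Preadditive.add_comp]; rfl

/-- Additivity in `s`. [cite: Hartshorne1977, II Ex. 5.1 (b)] -/
theorem twistHomOfSections_add_right (l : Γ(L, U)) (s s' : Γ(E, U)) :
    twistHomOfSections L E U l (s + s') = twistHomOfSections L E U l s + twistHomOfSections L E U l s' := by
  refine hom_ext_of_appLE fun W k (μ : L.over W ⟶ (unitModule X).over W) => ?_
  rw [appLE_add, appLE_twistHomOfSections, appLE_twistHomOfSections, appLE_twistHomOfSections, map_add,
    smul_add]

/-- `𝒪(U)`-linearity in `l`: `(a l) ⊗ s ↦ a • (λ ↦ λ(l) s)`. [cite: Hartshorne1977, II Ex. 5.1 (b)] -/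
theorem twistHomOfSections_smul_left (a : Γ(X, U)) (l : Γ(L, U)) (s : Γ(E, U)) :
    twistHomOfSections L E U (a • l) s = a • twistHomOfSections L E U l s := by
  refine hom_ext_of_appLE fun W k (μ : L.over W ⟶ (unitModule X).over W) => ?_
  rw [appLE_smul, appLE_twistHomOfSections, appLE_twistHomOfSections, Scheme.Modules.map_smul,
    appLE_smul_right, smul_assoc]

/-- `𝒪(U)`-linearity in `s`. [cite: Hartshorne1977, II Ex. 5.1 (b)] -/
theorem twistHomOfSections_smul_right (a : Γ(X, U)) (l : Γ(L, U)) (s : Γ(E, U)) :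
    twistHomOfSections L E U l (a • s) = a • twistHomOfSections L E U l s := by
  refine hom_ext_of_appLE fun W k (μ : L.over W ⟶ (unitModule X).over W) => ?_
  rw [appLE_smul, appLE_twistHomOfSections, appLE_twistHomOfSections, Scheme.Modules.map_smul,
    smul_comm]

/-- Restriction: `(λ ↦ λ(l) s)|_V = (λ ↦ λ(l|_V) s|_V)`. [cite: Hartshorne1977, II Ex. 5.1 (b)] -/
theorem restrictHom_twistHomOfSections (i : V ⟶ U) (l : Γ(L, U)) (s : Γ(E, U)) :
    restrictHom i (twistHomOfSections L E U l s) =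
      twistHomOfSections L E V (L.presheaf.map i.op l) (E.presheaf.map i.op s) := by
  refine hom_ext_of_appLE fun W k (μ : L.over W ⟶ (unitModule X).over W) => ?_
  rw [appLE_restrictHom, appLE_twistHomOfSections, appLE_twistHomOfSections, presheaf_map_map,
    presheaf_map_map]

/-- Post-composition with `g : E ⟶ E'`: `(λ ↦ λ(l) s) ≫ g|_U = (λ ↦ λ(l) g(s))`. [cite: Hartshorne1977, II Ex. 5.1 (b)] -/
theorem twistHomOfSections_comp_over_map {E' : X.Modules} (g : E ⟶ E') (l : Γ(L, U)) (s : Γ(E, U)) :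
    twistHomOfSections L E U l s ≫ (SheafOfModules.overFunctor _ U).map g =
      twistHomOfSections L E' U l (g.app U s) := by
  refine hom_ext_of_appLE fun W k (μ : L.over W ⟶ (unitModule X).over W) => ?_
  rw [appLE_comp_over_map, appLE_twistHomOfSections, appLE_twistHomOfSections,
    Scheme.Modules.Hom.app_smul, app_presheaf_map]

end Sections

/-! ### §2 The comparison `θ : L ⊗ E ⟶ 𝓗om(L^∨, E)` -/

section Comparison

variable (L E : X.Modules)

/-- The `𝒪(U)`-bilinear map `(l, s) ↦ (λ ↦ λ(l) • s)`, `Γ(L, U) × Γ(E, U) → Γ(𝓗om(L^∨, E), U)`.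
[cite: Hartshorne1977, II Ex. 5.1 (b)] -/
def twistBilin (U : X.Opens) :
    secMod L U →ₗ[secRing X U] secMod E U →ₗ[secRing X U] secMod (sheafHom (dual L) E) U :=
  LinearMap.mk₂ (secRing X U)
    (fun l s => (twistHomOfSections L E U l s : secMod (sheafHom (dual L) E) U))
    (fun l l' s => twistHomOfSections_add_left l l' s)
    (fun a l s => twistHomOfSections_smul_left a l s)
    (fun l s s' => twistHomOfSections_add_right l s s')
    (fun a l s => twistHomOfSections_smul_right a l s)

/-- Values of `twistBilin`. [cite: Hartshorne1977, II Ex. 5.1 (b)] -/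
theorem twistBilin_apply (U : X.Opens) (l : secMod L U) (s : secMod E U) :
    twistBilin L E U l s = (twistHomOfSections L E U l s : secMod (sheafHom (dual L) E) U) := rfl

/-- The presheaf-level comparison `L(U) ⊗_{𝒪(U)} E(U) → Γ(𝓗om(L^∨, E), U)`, `l ⊗ s ↦ (λ ↦ λ(l) • s)`,
natural in `U`. [cite: Hartshorne1977, II Ex. 5.1 (b)] -/
def tensorSheafHomDualPre :
    tensorPresheaf L E ⟶ (Scheme.Modules.toPresheafOfModules X).obj (sheafHom (dual L) E) where
  app U := ModuleCat.ofHom (Y := secMod (sheafHom (dual L) E) U.unop)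
    (TensorProduct.lift (twistBilin L E U.unop))
  naturality {U U'} i := by
    apply ModuleCat.hom_ext
    apply TensorProduct.ext'
    intro l s
    change TensorProduct.lift (twistBilin L E U'.unop) (resT L E i.unop.le (l ⊗ₜ s)) =
      restrictHom i.unop (twistHomOfSections L E U.unop l s)
    rw [resT_tmul, TensorProduct.lift.tmul, twistBilin_apply, restrictHom_twistHomOfSections]
    rfl

/-- On elementary tensors the presheaf-level comparison is `l ⊗ₜ s ↦ (λ ↦ λ(l) • s)`.
[cite: Hartshorne1977, II Ex. 5.1 (b)] -/
theorem tensorSheafHomDualPre_app_tmul (U : X.Opens) (l : secMod L U) (s : secMod E U) :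
    (tensorSheafHomDualPre L E).app (op U) (l ⊗ₜ[secRing X U] s) =
      (twistHomOfSections L E U l s : secMod (sheafHom (dual L) E) U) :=
  TensorProduct.lift.tmul _ _

/-- **The comparison `θ : L ⊗ E ⟶ 𝓗om(L^∨, E)`** (Hartshorne II Ex. 5.1 (b): the map
`𝓔^∨∨ ⊗ 𝓕 → 𝓗om(𝓔^∨, 𝓕)`, here with `𝓔^∨∨` replaced by `𝓔` through evaluation): the transpose of the
presheaf-level comparison across the sheafification adjunction. [cite: Hartshorne1977, II Ex. 5.1 (b)] -/
def tensorSheafHomDual : tensorObj L E ⟶ sheafHom (dual L) E :=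
  ((modulesSheafifyAdjunction X).homEquiv _ _).symm (tensorSheafHomDualPre L E)

/-- Composed with the sheafification unit, `θ` is the presheaf-level comparison.
[cite: Hartshorne1977, II Ex. 5.1 (b)] -/
theorem tensorUnitHom_comp_tensorSheafHomDual :
    tensorUnitHom L E ≫ (Scheme.Modules.toPresheafOfModules X).map (tensorSheafHomDual L E) =
      tensorSheafHomDualPre L E := by
  unfold tensorSheafHomDual tensorUnitHom
  rw [← Adjunction.homEquiv_unit, Equiv.apply_symm_apply]

/-- **Section formula `θ(l ⊗ s) = (λ ↦ λ(l) • s)`.** [cite: Hartshorne1977, II Ex. 5.1 (b)] -/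
theorem tensorSheafHomDual_app_tmulSection (U : X.Opens) (l : secMod L U) (s : secMod E U) :
    (tensorSheafHomDual L E).app U (tmulSection L E U l s) =
      (twistHomOfSections L E U l s : secMod (sheafHom (dual L) E) U) := by
  rw [tmulSection_def, ← tensorSheafHomDualPre_app_tmul, ← tensorUnitHom_comp_tensorSheafHomDual]
  rfl

end Comparison

/-! ### §3 Morphisms out of `M ⊗ N` are determined by their values on elementary tensors -/

section Ext

variable {M N F : X.Modules}

/-- **Two morphisms `M ⊗ N ⟶ F` that agree on all elementary tensors `m ⊗ n` of sections are equal**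
(the sheafification adjunction is a bijection on Hom-sets and a morphism out of the presheaf tensor
product is determined on pure tensors, `TensorProduct.ext`). [cite: StacksProject, Tag 01CA] -/
theorem tensorObj_hom_ext {φ ψ : tensorObj M N ⟶ F}
    (h : ∀ (U : X.Opens) (m : secMod M U) (n : secMod N U),
      φ.app U (tmulSection M N U m n) = ψ.app U (tmulSection M N U m n)) : φ = ψ := by
  apply ((modulesSheafifyAdjunction X).homEquiv _ _).injective
  rw [Adjunction.homEquiv_unit, Adjunction.homEquiv_unit]
  change tensorUnitHom M N ≫ _ = tensorUnitHom M N ≫ _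
  apply PresheafOfModules.hom_ext
  intro U
  apply ModuleCat.hom_ext
  apply TensorProduct.ext'
  intro m n
  exact h U.unop m n

end Ext

/-! ### §4 Naturality of `θ` in `E` -/

section Naturality

variable (L : X.Modules) {E E' : X.Modules}

/-- **Naturality of `θ` in `E`**: `(𝟙_L ⊗ g) ≫ θ_{E'} = θ_E ≫ 𝓗om(L^∨, g)` for `g : E ⟶ E'` (both
sides send `l ⊗ s` to `λ ↦ λ(l) • g(s)`). [cite: Hartshorne1977, II Ex. 5.1 (b)] -/
theorem tensorSheafHomDual_naturality (g : E ⟶ E') :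
    tensorMap (𝟙 L) g ≫ tensorSheafHomDual L E' = tensorSheafHomDual L E ≫ sheafHomMap (dual L) g := by
  refine tensorObj_hom_ext fun U l s => ?_
  change (tensorSheafHomDual L E').app U ((tensorMap (𝟙 L) g).app U (tmulSection L E U l s)) =
    (sheafHomMap (dual L) g).app U ((tensorSheafHomDual L E).app U (tmulSection L E U l s))
  rw [tensorMap_app_tmulSection, tensorSheafHomDual_app_tmulSection, tensorSheafHomDual_app_tmulSection,
    sheafHomMap_app_apply, twistHomOfSections_comp_over_map]
  rfl

/-- **`θ` as a natural transformation `L ⊗ – ⟶ 𝓗om(L^∨, –)`** of endofunctors of `Mod(𝒪_X)`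
(`Modules.tensorBifunctor`, `Modules.sheafHomFunctor`). [cite: Hartshorne1977, II Ex. 5.1 (b)] -/
def tensorSheafHomDualNatTrans : (tensorBifunctor X).obj L ⟶ sheafHomFunctor (dual L) where
  app E := tensorSheafHomDual L E
  naturality _ _ g := tensorSheafHomDual_naturality L g

/-- Components of the natural transformation. [cite: Hartshorne1977, II Ex. 5.1 (b)] -/
@[simp]
theorem tensorSheafHomDualNatTrans_app (E : X.Modules) :
    (tensorSheafHomDualNatTrans L).app E = tensorSheafHomDual L E := rfl

end Naturality

end Literature.AlgebraicGeometry.Modules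

end
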